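import Summits.Ventures.LatticeQCDFlow.Exactness.IMHSmithTierney
import HarnessLib

/-!
# The all-lag STICKING FLOOR of the flow sampler: `∫ g (Kⁿ⁺¹ g) w ≥ ∫ g² w r^{n+1}` for every observable

HONEST FRAMING: exact (Metropolis-corrected) sampling algorithms for lattice gauge theory;
figures of merit are autocorrelation/cost numbers at stated couplings and volumes; no
continuum-physics claim.  (SCALAR calibration rung S0-A: not a gauge result.)

Venture `LatticeQCDFlow` (cell pub-lqcd), topic `Exactness`; FANOUT row 2 (`s0-phi4`, FLOW arm).
NEW WORK of the cell, composing the cell's Smith–Tierney theorem (`IMHSmithTierney.lean`) with a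
layer cake on the kernel `T_{n+1}(b ∨ b')`.  Nothing is cited as a fact.  Relation to the tree:
`FlowSamplerPositive.lean` is the case `n = 0` (`T₁(b ∨ b') = 1/max(b, b')`); theory-2's
`sector_joint_lower_bound` (T2-R′) and row 11's `Scoring/StickingFloor` are finite-state SECTOR
versions; here EVERY bounded observable on a general state space.

## What is proved (`w, q > 0` measurable integrable, `∫ q = 1`; `g` bounded measurable;
`r(x) = ∫ (1 − α(x,z)) q(z) dμ(z)` the rejection probability; `K = imhOp μ w q`)

* `integral_Ioi_cutoff_stIntegrand` — `∫_{u>0} 1[a ∨ c < u] φₙ(u) e du = T_{n+1}(a ∨ c) e`;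
* **`integral_integral_stKernel_eq_sq`** —
  `∫∫ T_{n+1}(b(x) ∨ b(y)) g(y)w(y) g(x)w(x) = ∫_{u>0} φₙ(u) (∫ 1[b < u] g w dμ)² du`
  (triple Fubini), hence `integral_integral_stKernel_nonneg`: the Smith–Tierney kernel is positive
  semidefinite on `L²(w dμ)`;
* **`autocov_ge_sticking`** — for EVERY `n` and EVERY bounded measurable `g`:
  `∫ g² w r^{n+1} dμ ≤ ∫ g (Kⁿ⁺¹ g) w dμ`; **`autocorr_ge_sticking`** — the normalised form
  `ρ(n+1) ≥ E_{g²w}[r^{n+1}]/E[g²w]`; `imhOp_tauInt_ge_stickingSum` — under summability,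
  `τ_int ≥ ½ + Σ_{n<N} E_{g²w}[r^{n+1}]/E[g²w]` for every `N`;
* the lattice (`ℝ^Λ`, row 2's `imhOpPhi4 J λ q̃`, every `λ > 0`, real `J`, positive model density,
  bounded `f`, `g = f − ⟨f⟩`): **`phi4Flow_autocov_ge_sticking`**, **`phi4Flow_autocorr_ge_sticking`**.

Reading for S0-A (no numerics implied): for the flow arm the autocorrelation of ANY observable at
lag `n` is at least the `g²`-weighted `n`-th moment of the per-configuration rejection probability —
sticky configurations (`r` near 1, i.e. model weight far below target weight) put a floor under
every lag, not only under `ρ(1)` (`FlowSamplerTauIntFloor`: `τ_int ≥ ½ + r_g/(1 − r_g)` used only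
the first moment; by Jensen `E[rⁿ] ≥ (E r)ⁿ` the present floor is never weaker).
NOT CLAIMED: the summed form `τ_int ≥ ½ + E_{g²}[r/(1 − r)]` (needs `r < 1` a.e.; left to a
successor), HMC / local Metropolis, unbounded observables, numbers for any trained network.
-/

namespace Summit.Ventures.LatticeQCDFlow.Exactness

open Real MeasureTheory Filter Set Topology
open Summit.Ventures.LatticeQCDFlow.Scoring

/-- Product of two upper cut-offs is the cut-off at the maximum. -/
theorem ite_gt_mul_ite_gt (u a c e f : ℝ) :
    (if a < u then e else 0) * (if c < u then f else 0) = if max a c < u then e * f else 0 := by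
  by_cases ha : a < u
  · by_cases hc : c < u
    · rw [if_pos ha, if_pos hc, if_pos (max_lt ha hc)]
    · rw [if_pos ha, if_neg hc, if_neg (fun h => hc ((le_max_right _ _).trans_lt h)), mul_zero]
  · rw [if_neg ha, zero_mul, if_neg (fun h => ha ((le_max_left _ _).trans_lt h))]

variable {X : Type*} [MeasurableSpace X] {μ : Measure X} {w q : X → ℝ}

variable [SFinite μ]

omit [SFinite μ] in
/-- The kernel at a maximum is a half-line integral with two cut-offs:
`∫_{u>0} 1[a<u] 1[c<u] φₙ(u) e du = T_{n+1}(a ∨ c) · e` (`a, c > 0`). -/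
theorem integral_Ioi_cutoff_stIntegrand (n : ℕ) {a c : ℝ} (ha : 0 < a) (e : ℝ) :
    ∫ u in Ioi (0:ℝ), (if max a c < u then
        ((n : ℝ) + 1) * rejCurve μ w q u ^ n / u ^ 2 * e else 0)
      = stKernel μ w q n (max a c) * e := by
  have hm : 0 < max a c := lt_max_of_lt_left ha
  have e1 : (fun u : ℝ => if max a c < u then ((n : ℝ) + 1) * rejCurve μ w q u ^ n / u ^ 2 * e else 0)
      = (Ioi (max a c)).indicator fun u => ((n : ℝ) + 1) * rejCurve μ w q u ^ n / u ^ 2 * e := by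
    funext u
    simp only [Set.indicator_apply, Set.mem_Ioi]
  rw [e1, MeasureTheory.integral_indicator measurableSet_Ioi, Measure.restrict_restrict measurableSet_Ioi,
    Ioi_inter_Ioi, sup_eq_left.2 hm.le]
  unfold stKernel
  rw [← MeasureTheory.integral_mul_const]

/-- **THE SMITH–TIERNEY KERNEL IS POSITIVE SEMIDEFINITE (layer cake).**  For bounded measurable `g`:
`∫∫ T_{n+1}(b(x) ∨ b(y)) g(y) w(y) g(x) w(x) dμ dμ = ∫_{u>0} φₙ(u) (∫ 1[b < u] g w dμ)² du ≥ 0`. -/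
theorem integral_integral_stKernel_eq_sq (hw0 : ∀ t, 0 < w t) (hwm : Measurable w)
    (hwi : Integrable w μ) (hq0 : ∀ t, 0 < q t) (hqm : Measurable q) (hqi : Integrable q μ)
    (hq1 : ∫ z, q z ∂μ = 1) (n : ℕ) {g : X → ℝ} (hgm : Measurable g) {B : ℝ}
    (hgb : ∀ t, |g t| ≤ B) :
    ∫ x, ∫ y, stKernel μ w q n (max (w x / q x) (w y / q y)) * g y * w y * (g x * w x) ∂μ ∂μ
      = ∫ u in Ioi (0:ℝ), ((n : ℝ) + 1) * rejCurve μ w q u ^ n / u ^ 2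
          * (∫ x, (if w x / q x < u then g x * w x else 0) ∂μ) ^ 2 := by
  set ν : Measure ℝ := volume.restrict (Ioi 0) with hν
  set φ : ℝ → ℝ := fun u => ((n : ℝ) + 1) * rejCurve μ w q u ^ n / u ^ 2 with hφ
  set c : ℝ → X → ℝ := fun u x => if w x / q x < u then g x * w x else 0 with hc
  have hbm : Measurable fun t => w t / q t := hwm.div hqm
  have hb0 : ∀ t, 0 < w t / q t := fun t => div_pos (hw0 t) (hq0 t)
  have hφm : Measurable φ := measurable_stIntegrand hwm hqm n
  have hSb : ∀ v, 0 < v → 0 ≤ stKernel μ w q n v ∧ stKernel μ w q n v ≤ ((n : ℝ) + 1) / v :=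
    fun v hv => stKernel_bounds hw0 hwm hq0 hqm hqi hq1 n hv
  have hcm : Measurable fun z : X × ℝ => c z.2 z.1 := by
    simp only [hc]
    exact Measurable.ite (measurableSet_lt (hbm.comp measurable_fst) measurable_snd)
      ((hgm.mul hwm).comp measurable_fst) measurable_const
  -- the integrand on `(X × X) × ℝ`: `φ(u) c(u,x) c(u,y)`
  have hFm : Measurable fun z : (X × X) × ℝ => φ z.2 * (c z.2 z.1.1 * c z.2 z.1.2) :=
    (hφm.comp measurable_snd).mul
      ((hcm.comp ((measurable_fst.comp measurable_fst).prodMk measurable_snd)).mul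
        (hcm.comp ((measurable_snd.comp measurable_fst).prodMk measurable_snd)))
  have hprod_eq : ∀ (u : ℝ) (x y : X), φ u * (c u x * c u y)
      = if max (w x / q x) (w y / q y) < u then
          ((n : ℝ) + 1) * rejCurve μ w q u ^ n / u ^ 2 * (g x * w x * (g y * w y)) else 0 := by
    intro u x y
    simp only [hc, hφ]
    rw [ite_gt_mul_ite_gt]
    split_ifs <;> ring
  have hF_eq : ∀ x y, ∫ u, φ u * (c u x * c u y) ∂ν
      = stKernel μ w q n (max (w x / q x) (w y / q y)) * g y * w y * (g x * w x) := by
    intro x y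
    simp_rw [hprod_eq]
    rw [hν, integral_Ioi_cutoff_stIntegrand n (hb0 x)]
    ring
  have hnorm_eq : ∀ x y, ∫ u, ‖φ u * (c u x * c u y)‖ ∂ν
      = stKernel μ w q n (max (w x / q x) (w y / q y)) * (|g x| * w x * (|g y| * w y)) := by
    intro x y
    have hm : 0 < max (w x / q x) (w y / q y) := lt_max_of_lt_left (hb0 x)
    have e : ∀ u, ‖φ u * (c u x * c u y)‖
        = if max (w x / q x) (w y / q y) < u then
            ((n : ℝ) + 1) * rejCurve μ w q u ^ n / u ^ 2 * (|g x| * w x * (|g y| * w y)) else 0 := by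
      intro u
      rw [hprod_eq, Real.norm_eq_abs]
      split_ifs with h
      · obtain ⟨h0, -⟩ := stIntegrand_bounds hw0 hq0 hqi hq1 n (hm.trans h) (μ := μ)
        rw [abs_mul, abs_of_nonneg h0, abs_mul, abs_mul, abs_mul, abs_of_pos (hw0 x),
          abs_of_pos (hw0 y)]
      · exact abs_zero
    simp_rw [e]
    rw [hν, integral_Ioi_cutoff_stIntegrand n (hb0 x)]
  -- integrability on the triple product
  have hFint : Integrable (fun z : (X × X) × ℝ => φ z.2 * (c z.2 z.1.1 * c z.2 z.1.2))
      ((μ.prod μ).prod ν) := by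
    rw [integrable_prod_iff hFm.aestronglyMeasurable]
    constructor
    · refine Eventually.of_forall fun p => ?_
      have hm : 0 < max (w p.1 / q p.1) (w p.2 / q p.2) := lt_max_of_lt_left (hb0 p.1)
      have e : (fun u => φ u * (c u p.1 * c u p.2))
          = (Ioi (max (w p.1 / q p.1) (w p.2 / q p.2))).indicator
              (fun u => ((n : ℝ) + 1) * rejCurve μ w q u ^ n / u ^ 2 * (g p.1 * w p.1 * (g p.2 * w p.2))) := by
        funext u
        rw [hprod_eq]
        simp only [Set.indicator_apply, Set.mem_Ioi]
      rw [e, integrable_indicator_iff measurableSet_Ioi]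
      have hi := (integrableOn_stIntegrand hw0 hwm hq0 hqm hqi hq1 n hm).mul_const
        (g p.1 * w p.1 * (g p.2 * w p.2))
      rw [IntegrableOn, hν, Measure.restrict_restrict measurableSet_Ioi, Ioi_inter_Ioi,
        sup_eq_left.2 hm.le]
      exact hi
    · have e : (fun p : X × X => ∫ u, ‖φ u * (c u p.1 * c u p.2)‖ ∂ν)
          = fun p => stKernel μ w q n (max (w p.1 / q p.1) (w p.2 / q p.2))
              * (|g p.1| * w p.1 * (|g p.2| * w p.2)) := by
        funext p
        exact hnorm_eq p.1 p.2
      rw [e]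
      have hG : Integrable (fun p : X × X => w p.1 * q p.2) (μ.prod μ) := hwi.mul_prod hqi
      refine Integrable.mono' (hG.const_mul (((n : ℝ) + 1) * B ^ 2))
        ((((measurable_stKernel hwm hqm n).comp ((hbm.comp measurable_fst).max
          (hbm.comp measurable_snd))).mul
          ((((continuous_abs.measurable.comp (hgm.comp measurable_fst))).mul
            (hwm.comp measurable_fst)).mul
            ((continuous_abs.measurable.comp (hgm.comp measurable_snd)).mul
              (hwm.comp measurable_snd)))).aestronglyMeasurable)
        (Eventually.of_forall fun p => ?_)
      have hB : 0 ≤ B := (abs_nonneg _).trans (hgb p.1)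
      have hm : 0 < max (w p.1 / q p.1) (w p.2 / q p.2) := lt_max_of_lt_left (hb0 p.1)
      obtain ⟨hS0, hS1⟩ := hSb _ hm
      have hS2 : stKernel μ w q n (max (w p.1 / q p.1) (w p.2 / q p.2)) ≤ ((n : ℝ) + 1) / (w p.2 / q p.2) :=
        hS1.trans (div_le_div_of_nonneg_left (by positivity) (hb0 p.2) (le_max_right _ _))
      rw [Real.norm_eq_abs, abs_of_nonneg (mul_nonneg hS0 (mul_nonneg
        (mul_nonneg (abs_nonneg _) (hw0 _).le) (mul_nonneg (abs_nonneg _) (hw0 _).le)))]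
      have hq2 := (hq0 p.2).ne'
      have hw2 := hw0 p.2
      calc stKernel μ w q n (max (w p.1 / q p.1) (w p.2 / q p.2)) * (|g p.1| * w p.1 * (|g p.2| * w p.2))
          ≤ ((n : ℝ) + 1) / (w p.2 / q p.2) * (B * w p.1 * (B * w p.2)) :=
            mul_le_mul hS2 (mul_le_mul (mul_le_mul_of_nonneg_right (hgb _) (hw0 _).le)
              (mul_le_mul_of_nonneg_right (hgb _) (hw0 _).le)
              (mul_nonneg (abs_nonneg _) (hw0 _).le) (mul_nonneg hB (hw0 _).le))
              (mul_nonneg (mul_nonneg (abs_nonneg _) (hw0 _).le) (mul_nonneg (abs_nonneg _) (hw0 _).le))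
              (div_nonneg (by positivity) (hb0 p.2).le)
        _ = ((n : ℝ) + 1) * B ^ 2 * (w p.1 * q p.2) := by
            field_simp
  -- Fubini
  calc ∫ x, ∫ y, stKernel μ w q n (max (w x / q x) (w y / q y)) * g y * w y * (g x * w x) ∂μ ∂μ
      = ∫ x, ∫ y, ∫ u, φ u * (c u x * c u y) ∂ν ∂μ ∂μ := by
        simp_rw [hF_eq]
    _ = ∫ p, ∫ u, φ u * (c u p.1 * c u p.2) ∂ν ∂(μ.prod μ) :=
        (integral_prod (fun p : X × X => ∫ u, φ u * (c u p.1 * c u p.2) ∂ν) hFint.integral_prod_left).symm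
    _ = ∫ u, ∫ p, φ u * (c u p.1 * c u p.2) ∂(μ.prod μ) ∂ν :=
        integral_integral_swap (f := fun (p : X × X) (u : ℝ) => φ u * (c u p.1 * c u p.2)) hFint
    _ = ∫ u, φ u * (∫ t, c u t ∂μ) ^ 2 ∂ν := by
        refine integral_congr_ae (Eventually.of_forall fun u => ?_)
        dsimp only
        rw [MeasureTheory.integral_const_mul, sq]
        congr 1
        exact integral_prod_mul (fun t => c u t) (fun t => c u t)

/-- **Nonnegativity of the Smith–Tierney form.** -/
theorem integral_integral_stKernel_nonneg (hw0 : ∀ t, 0 < w t) (hwm : Measurable w)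
    (hwi : Integrable w μ) (hq0 : ∀ t, 0 < q t) (hqm : Measurable q) (hqi : Integrable q μ)
    (hq1 : ∫ z, q z ∂μ = 1) (n : ℕ) {g : X → ℝ} (hgm : Measurable g) {B : ℝ}
    (hgb : ∀ t, |g t| ≤ B) :
    0 ≤ ∫ x, ∫ y, stKernel μ w q n (max (w x / q x) (w y / q y)) * g y * w y * (g x * w x) ∂μ ∂μ := by
  rw [integral_integral_stKernel_eq_sq hw0 hwm hwi hq0 hqm hqi hq1 n hgm hgb]
  refine setIntegral_nonneg measurableSet_Ioi fun u hu => ?_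
  exact mul_nonneg (stIntegrand_bounds hw0 hq0 hqi hq1 n hu (μ := μ)).1 (sq_nonneg _)

/-- **THE ALL-LAG STICKING FLOOR OF THE EXACT FLOW SAMPLER.**  `w, q > 0` measurable integrable,
`∫ q = 1`; `g` bounded measurable (no centring needed); `r(x) = ∫ (1 − α(x,z)) q(z) dμ(z)` the
rejection probability from `x`.  Then for every `n`:
`∫ g² w r^{n+1} dμ ≤ ∫ g (Kⁿ⁺¹ g) w dμ` — the lag-`(n+1)` stationary autocovariance is at least
the contribution of the paths that reject `n+1` times in a row, FOR EVERY OBSERVABLE. -/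
theorem autocov_ge_sticking (hw0 : ∀ t, 0 < w t) (hwm : Measurable w) (hwi : Integrable w μ)
    (hq0 : ∀ t, 0 < q t) (hqm : Measurable q) (hqi : Integrable q μ) (hq1 : ∫ z, q z ∂μ = 1)
    (n : ℕ) {g : X → ℝ} (hgm : Measurable g) {B : ℝ} (hgb : ∀ t, |g t| ≤ B) :
    ∫ x, g x ^ 2 * w x * (∫ z, (1 - imhAcceptQ w q x z) * q z ∂μ) ^ (n + 1) ∂μ
      ≤ ∫ x, g x * ((imhOp μ w q)^[n + 1] g) x * w x ∂μ := by
  have hb0 : ∀ t, 0 < w t / q t := fun t => div_pos (hw0 t) (hq0 t)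
  have hbm : Measurable fun t => w t / q t := hwm.div hqm
  have hST := imhOp_iterate_succ_eq hw0 hwm hwi hq0 hqm hqi hq1 n hgm hgb
  have hlam : ∀ v, 0 < v → 0 ≤ rejCurve μ w q v ∧ rejCurve μ w q v ≤ 1 := fun v hv => by
    obtain ⟨h0, h1⟩ := rejCurve_bounds hw0 hq0 hqi hv (μ := μ)
    rw [hq1] at h1
    exact ⟨h0, h1⟩
  -- rewrite both sides in Smith–Tierney form
  have e1 : ∀ x, g x * ((imhOp μ w q)^[n + 1] g) x * w x
      = (∫ y, stKernel μ w q n (max (w x / q x) (w y / q y)) * g y * w y * (g x * w x) ∂μ)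
        + g x ^ 2 * w x * rejCurve μ w q (w x / q x) ^ (n + 1) := by
    intro x
    rw [hST x]
    have e : ∫ y, stKernel μ w q n (max (w x / q x) (w y / q y)) * g y * w y * (g x * w x) ∂μ
        = (∫ y, stKernel μ w q n (max (w x / q x) (w y / q y)) * g y * w y ∂μ) * (g x * w x) :=
      MeasureTheory.integral_mul_const _ _
    rw [e]
    ring
  have e2 : ∀ x, g x ^ 2 * w x * (∫ z, (1 - imhAcceptQ w q x z) * q z ∂μ) ^ (n + 1)
      = g x ^ 2 * w x * rejCurve μ w q (w x / q x) ^ (n + 1) := by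
    intro x
    rw [rejection_eq_rejCurve hw0 hq0]
  simp_rw [e1, e2]
  -- integrability of the two pieces
  have hSb : ∀ v, 0 < v → 0 ≤ stKernel μ w q n v ∧ stKernel μ w q n v ≤ ((n : ℝ) + 1) / v :=
    fun v hv => stKernel_bounds hw0 hwm hq0 hqm hqi hq1 n hv
  have hF : Integrable (Function.uncurry fun (x y : X) =>
      stKernel μ w q n (max (w x / q x) (w y / q y)) * g y * w y * (g x * w x)) (μ.prod μ) := by
    have hmeas : Measurable (Function.uncurry fun (x y : X) =>
        stKernel μ w q n (max (w x / q x) (w y / q y)) * g y * w y * (g x * w x)) :=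
      ((((measurable_stKernel hwm hqm n).comp ((hbm.comp measurable_fst).max
        (hbm.comp measurable_snd))).mul (hgm.comp measurable_snd)).mul (hwm.comp measurable_snd)).mul
        ((hgm.comp measurable_fst).mul (hwm.comp measurable_fst))
    have hG : Integrable (fun p : X × X => w p.1 * ((((n : ℝ) + 1) * B * B) * q p.2)) (μ.prod μ) :=
      hwi.mul_prod (hqi.const_mul _)
    refine Integrable.mono' hG hmeas.aestronglyMeasurable (Eventually.of_forall fun p => ?_)
    have hB : 0 ≤ B := (abs_nonneg _).trans (hgb p.1)
    have hm : 0 < max (w p.1 / q p.1) (w p.2 / q p.2) := lt_max_of_lt_left (hb0 p.1)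
    obtain ⟨hS0, hS1⟩ := hSb _ hm
    have hS2 : stKernel μ w q n (max (w p.1 / q p.1) (w p.2 / q p.2)) ≤ ((n : ℝ) + 1) / (w p.2 / q p.2) :=
      hS1.trans (div_le_div_of_nonneg_left (by positivity) (hb0 p.2) (le_max_right _ _))
    rw [Real.norm_eq_abs]
    show |stKernel μ w q n (max (w p.1 / q p.1) (w p.2 / q p.2)) * g p.2 * w p.2 * (g p.1 * w p.1)|
      ≤ w p.1 * ((((n : ℝ) + 1) * B * B) * q p.2)
    rw [abs_mul, abs_mul, abs_mul, abs_mul, abs_of_nonneg hS0, abs_of_pos (hw0 p.2), abs_of_pos (hw0 p.1)]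
    have hq2 := (hq0 p.2).ne'
    have hw2 := hw0 p.2
    calc stKernel μ w q n (max (w p.1 / q p.1) (w p.2 / q p.2)) * |g p.2| * w p.2 * (|g p.1| * w p.1)
        ≤ ((n : ℝ) + 1) / (w p.2 / q p.2) * B * w p.2 * (B * w p.1) :=
          mul_le_mul (mul_le_mul_of_nonneg_right (mul_le_mul hS2 (hgb _) (abs_nonneg _)
            (div_nonneg (by positivity) (hb0 p.2).le)) hw2.le)
            (mul_le_mul_of_nonneg_right (hgb _) (hw0 _).le) (mul_nonneg (abs_nonneg _) (hw0 _).le)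
            (mul_nonneg (mul_nonneg (div_nonneg (by positivity) (hb0 p.2).le) hB) hw2.le)
      _ = w p.1 * ((((n : ℝ) + 1) * B * B) * q p.2) := by
          field_simp
  have hI1 : Integrable (fun x => ∫ y, stKernel μ w q n (max (w x / q x) (w y / q y)) * g y * w y
      * (g x * w x) ∂μ) μ := hF.integral_prod_left
  have hg2b : ∀ t, |g t ^ 2| ≤ B ^ 2 := fun t => by
    rw [abs_pow]; exact pow_le_pow_left₀ (abs_nonneg _) (hgb t) 2
  have hI2 : Integrable (fun x => g x ^ 2 * w x * rejCurve μ w q (w x / q x) ^ (n + 1)) μ := by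
    refine Integrable.mono' (hwi.const_mul (B ^ 2)) (((hgm.pow_const 2).mul hwm).mul
      (((measurable_rejCurve hwm hqm).comp hbm).pow_const _)).aestronglyMeasurable
      (Eventually.of_forall fun x => ?_)
    obtain ⟨hl0, hl1⟩ := hlam _ (hb0 x)
    rw [Real.norm_eq_abs, abs_mul, abs_mul, abs_of_pos (hw0 x), abs_of_nonneg (pow_nonneg hl0 _)]
    calc |g x ^ 2| * w x * rejCurve μ w q (w x / q x) ^ (n + 1) ≤ B ^ 2 * w x * 1 :=
          mul_le_mul (mul_le_mul_of_nonneg_right (hg2b x) (hw0 x).le) (pow_le_one₀ hl0 hl1)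
            (pow_nonneg hl0 _) (mul_nonneg (sq_nonneg _) (hw0 x).le)
      _ = B ^ 2 * w x := mul_one _
  rw [integral_add hI1 hI2]
  have h0 := integral_integral_stKernel_nonneg hw0 hwm hwi hq0 hqm hqi hq1 n hgm hgb
  linarith

/-- **`ρ(n+1) ≥ E_{g²w}[r^{n+1}] / E[g²w]`**: the normalised form of the all-lag sticking floor
(`g²`-weighted moments of the rejection probability bound every autocorrelation from below). -/
theorem autocorr_ge_sticking (hw0 : ∀ t, 0 < w t) (hwm : Measurable w) (hwi : Integrable w μ)
    (hq0 : ∀ t, 0 < q t) (hqm : Measurable q) (hqi : Integrable q μ) (hq1 : ∫ z, q z ∂μ = 1)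
    (n : ℕ) {g : X → ℝ} (hgm : Measurable g) {B : ℝ} (hgb : ∀ t, |g t| ≤ B) :
    (∫ x, g x ^ 2 * w x * (∫ z, (1 - imhAcceptQ w q x z) * q z ∂μ) ^ (n + 1) ∂μ)
        / ∫ x, g x ^ 2 * w x ∂μ
      ≤ (∫ x, g x * ((imhOp μ w q)^[n + 1] g) x * w x ∂μ) / ∫ x, g x ^ 2 * w x ∂μ :=
  div_le_div_of_nonneg_right (autocov_ge_sticking hw0 hwm hwi hq0 hqm hqi hq1 n hgm hgb)
    (integral_nonneg fun x => mul_nonneg (sq_nonneg _) (hw0 x).le)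

/-- **Partial-sum sticking floor on `τ_int`.**  If the autocorrelation series of the bounded
measurable `g` along the exact chain is summable, then for every `N`:
`½ + Σ_{n<N} E_{g²w}[r^{n+1}]/E[g²w] ≤ τ_int` (all autocorrelations are `≥ 0`, each one at least
its sticking moment). -/
theorem imhOp_tauInt_ge_stickingSum (hw0 : ∀ t, 0 < w t) (hwm : Measurable w)
    (hwi : Integrable w μ) (hq0 : ∀ t, 0 < q t) (hqm : Measurable q) (hqi : Integrable q μ)
    (hq1 : ∫ z, q z ∂μ = 1) {g : X → ℝ} (hgm : Measurable g) {B : ℝ} (hgb : ∀ t, |g t| ≤ B)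
    (hs : Summable fun n => (∫ x, g x * ((imhOp μ w q)^[n + 1] g) x * w x ∂μ)
      / ∫ x, g x ^ 2 * w x ∂μ) (N : ℕ) :
    1 / 2 + ∑ n ∈ Finset.range N,
        (∫ x, g x ^ 2 * w x * (∫ z, (1 - imhAcceptQ w q x z) * q z ∂μ) ^ (n + 1) ∂μ)
          / ∫ x, g x ^ 2 * w x ∂μ
      ≤ tauInt (fun n => (∫ x, g x * ((imhOp μ w q)^[n] g) x * w x ∂μ) / ∫ x, g x ^ 2 * w x ∂μ) := by
  have hA0 : 0 ≤ ∫ x, g x ^ 2 * w x ∂μ := integral_nonneg fun x => mul_nonneg (sq_nonneg _) (hw0 x).le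
  have hnn : ∀ n, 0 ≤ (∫ x, g x * ((imhOp μ w q)^[n + 1] g) x * w x ∂μ) / ∫ x, g x ^ 2 * w x ∂μ :=
    fun n => div_nonneg (autocov_nonneg hw0 hwm hwi hq0 hqm hqi hq1 hgm hgb (n + 1)) hA0
  have h1 : ∑ n ∈ Finset.range N,
      (∫ x, g x ^ 2 * w x * (∫ z, (1 - imhAcceptQ w q x z) * q z ∂μ) ^ (n + 1) ∂μ)
        / ∫ x, g x ^ 2 * w x ∂μ
      ≤ ∑ n ∈ Finset.range N,
        (∫ x, g x * ((imhOp μ w q)^[n + 1] g) x * w x ∂μ) / ∫ x, g x ^ 2 * w x ∂μ :=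
    Finset.sum_le_sum fun n _ => autocorr_ge_sticking hw0 hwm hwi hq0 hqm hqi hq1 n hgm hgb
  have h2 := hs.sum_le_tsum (Finset.range N) fun n _ => hnn n
  unfold tauInt
  linarith

/-! ## The lattice: row 2's φ⁴ flow sampler -/

section Lattice

variable {n : ℕ}

/-- **ALL-LAG STICKING FLOOR FOR THE φ⁴ FLOW SAMPLER.**  Every `λ > 0`, every real `J`, EVERY
positive measurable model density with `∫ q̃ = 1` (no weight bound); `f` bounded measurable,
`g = f − ⟨f⟩`, `r(φ) = ∫ (1 − α(φ,φ')) q̃(φ') dφ'` the rejection probability.  For every lag `k`: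
`∫ g² e^{−S} r^{k+1} dφ ≤ ∫ g (K^{k+1} g) e^{−S} dφ`. -/
theorem phi4Flow_autocov_ge_sticking {lam : ℝ} (hlam : 0 < lam) (J : Fin (n + 1) → Fin (n + 1) → ℝ)
    {q : (Fin (n + 1) → ℝ) → ℝ} (hq0 : ∀ φ, 0 < q φ) (hqm : Measurable q) (hqi : Integrable q)
    (hq1 : ∫ φ, q φ = 1) {f : (Fin (n + 1) → ℝ) → ℝ} (hfm : Measurable f) {B : ℝ}
    (hfb : ∀ φ, |f φ| ≤ B) (k : ℕ) :
    ∫ φ, (f φ - gibbsExpect J lam f) ^ 2 * gibbsWeight J lam φ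
        * (∫ φ', (1 - imhAcceptQ (gibbsWeight J lam) q φ φ') * q φ') ^ (k + 1)
      ≤ ∫ φ, (f φ - gibbsExpect J lam f)
        * ((imhOpPhi4 J lam q)^[k + 1] (fun ψ => f ψ - gibbsExpect J lam f)) φ * gibbsWeight J lam φ := by
  obtain ⟨hgm, hgb, -⟩ := centred_observable hlam J hfm hfb
  rw [imhOpPhi4_eq_imhOp]
  exact autocov_ge_sticking (μ := volume) (fun φ => gibbsWeight_pos J lam φ)
    (continuous_gibbsWeight J lam).measurable (integrable_gibbsWeight hlam J) hq0 hqm hqi hq1 k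
    hgm hgb

/-- **`ρ(k+1) ≥ E_{g²}[r^{k+1}]/E[g²]` for the φ⁴ flow sampler** (normalised form), and hence every
window and `τ_int` inherit the sticking moments of the rejection probability. -/
theorem phi4Flow_autocorr_ge_sticking {lam : ℝ} (hlam : 0 < lam) (J : Fin (n + 1) → Fin (n + 1) → ℝ)
    {q : (Fin (n + 1) → ℝ) → ℝ} (hq0 : ∀ φ, 0 < q φ) (hqm : Measurable q) (hqi : Integrable q)
    (hq1 : ∫ φ, q φ = 1) {f : (Fin (n + 1) → ℝ) → ℝ} (hfm : Measurable f) {B : ℝ}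
    (hfb : ∀ φ, |f φ| ≤ B) (k : ℕ) :
    (∫ φ, (f φ - gibbsExpect J lam f) ^ 2 * gibbsWeight J lam φ
        * (∫ φ', (1 - imhAcceptQ (gibbsWeight J lam) q φ φ') * q φ') ^ (k + 1))
        / ∫ φ, (f φ - gibbsExpect J lam f) ^ 2 * gibbsWeight J lam φ
      ≤ (∫ φ, (f φ - gibbsExpect J lam f)
          * ((imhOpPhi4 J lam q)^[k + 1] (fun ψ => f ψ - gibbsExpect J lam f)) φ * gibbsWeight J lam φ)
        / ∫ φ, (f φ - gibbsExpect J lam f) ^ 2 * gibbsWeight J lam φ := by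
  obtain ⟨hgm, hgb, -⟩ := centred_observable hlam J hfm hfb
  rw [imhOpPhi4_eq_imhOp]
  exact autocorr_ge_sticking (μ := volume) (fun φ => gibbsWeight_pos J lam φ)
    (continuous_gibbsWeight J lam).measurable (integrable_gibbsWeight hlam J) hq0 hqm hqi hq1 k
    hgm hgb

end Lattice

end Summit.Ventures.LatticeQCDFlow.Exactness
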